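import Summits.Ventures.CertifiedManyBodySolver.Observables.StiffnessKinematicLeafDensity
import Summits.Ventures.CertifiedManyBodySolver.Certificates.HubbardSquare_n7o8_kinetic_classfloor_r354_r261_r445_r257
import HarnessLib

/-!
# Ventures/CertifiedManyBodySolver — Observables/DerivedHoppingFloorTTPrime.lean

HONEST FRAMING: an ANCHOR-GENERIC, zero-compute DERIVED a-priori FLOOR on the TOTAL (nearest-neighbour + `t′`·diagonal) hopping energy of
the torus-limit ground-state class at ANY burst anchor `(U, n, t′)` from a certified energy CAP and a certified double-occupancy FLOOR there —
the `t′`-generic form of the mechanism behind registry rows 26 / 27 / 34 (`U·d_lo − hi ≤ −hop(ω)`). NOT a stiffness statement at `t′ ≠ 0`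
(the f-sum functional weighs the diagonal bonds with relative weight `2t′`, `Observables/StiffnessTLKineticTTOrbitDictionary.lean`), NOT a
stiffness floor (none exists in this class, `Observables/StiffnessNoFloor.lean`), not informative vs print, not a superconductivity verdict.

Cell `hubbard-obs` (D-0042), seat p2 (stiffness), `prover-hubbard-obs-p2-g11-0`. The `t′ = 0` generic theorems are p2 g9's
`Observables.torusLimit_negKinetic_ge_of_doccFloor_of_cap` / `…_of_doccLowerRow_of_cap` (`StiffnessKinematicLeaf.lean` §5, p443588) — the ones the
obs-lit node emitter (gen-v6.5 §3) instantiates per anchor; at `t′ ≠ 0` only the (8, 7/8, −¼)-specific identity `m3_tpm1o4_hoppingDensity_eq`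
(obs-lit, `Certificates/HubbardSquare_n7o8_kinetic_tpm1o4_derived_r448_r257.lean`) existed. This module supplies the generic `t′` form so that the
burst's `t′ ≠ 0` anchors (A2/A0 = (8, 7/8, −¼), A3 = (8, 7/8, +¼), A9 = (8, 4/5, −¼), A10, …) read their derived hopping floor from a menu's
`docc lo` edge by ONE line, exactly as the `t′ = 0` anchors do (lead RULING (em4) d179: candidate id `OBS.hop.tpm1o4.TLderivedFloor445xT2docc`).

* `torusLimit_hoppingDensityTT'_eq` — for every torus limit `ω` of unit `(rectN n L, S^z = 0)`-sector ground states of `hubbardTorusTT' L 1 t′ U`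
  (`U ≥ 0`, `0 ≤ n < 2`): `k_NN(ω) + Σ_s Re ω(Φ^{t′}{0, j_s}) = e(1, t′, U, n) − U·Re ω(n_{0↑}n_{0↓})`, with
  `k_NN(ω) = Σ_i (−1)Σ_σ(Re ω(c†_{0σ}c_{e_iσ}) + Re ω(c†_{e_iσ}c_{0σ}))` and `Φ^{t′} = (diagHoppingFermionInteraction t′).Φ`.
* `torusLimit_negHoppingTT'_ge_of_doccFloor_of_cap` — a cap `e(1,t′,U,n) ≤ hi` and a class-wide docc floor `d_lo ≤ Re ω(n↑n↓)` give
  `U·d_lo − hi ≤ −(k_NN(ω) + Σ_s Re ω(Φ^{t′}{0,j_s}))` on the class; `…_of_doccLowerRow_of_cap` = the same from a registry-shaped cell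
  `SquareTTPrimeCorrLowerRow t′ U n u d_lo {0} (doccAt0 2)`.
* consistency: `m3_tpm1o4_hoppingDensity_le_derived_r445_r257_generic` re-derives registry row 27 (`OBS.hop.tpm1o4.TLderivedFloor445x257`:
  `−hop(8, 7/8, −¼) ≥ 453504579244274003115851/2⁷⁹ ≈ 0.7502603`, obs-lit/p2 g8 `m3_tpm1o4_hoppingDensity_le_derived_r445_r257`, p433540) from the
  generic theorem with the SAME premises (#445 ∧ #257) — same literal.

References: O. Bratteli, D. W. Robinson, OAQSM II (1997) §6.2.4 [BratteliRobinsonII1997]; T. Koma, H. Tasaki, J. Stat. Phys. 76 (1994) 745, §1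
[KomaTasaki1994]; D. J. Scalapino, S. R. White, S.-C. Zhang, PRB 47 (1993) 7995, §II [ScalapinoWhiteZhang1993].
-/

noncomputable section

namespace Summit.Ventures.CertifiedManyBodySolver.Observables

open Literature.MathematicalPhysics.QuantumLattice
open Literature.MathematicalPhysics.QuantumLattice.ThermodynamicLimit
open Literature.Probability.LatticeModels
open Summit.Ventures.CertifiedManyBodySolver.Certificates
open Matrix Finset Filter Topology HubbardWave0
open scoped Matrix BigOperators ComplexOrder

/-! ## §1 The total hopping energy of the class at `(U, n, t′)` is `e₀ − U·docc` -/

/-- **The TOTAL hopping energy density of the torus-limit ground-state class at `(U, n, t′)` is `e(1,t′,U,n) − U·docc`** (`U ≥ 0`,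
`0 ≤ n < 2`): for every torus limit `ω` of unit `(rectN n L, S^z = 0)`-sector ground states of `hubbardTorusTT' L 1 t′ U`,
`k_NN(ω) + Σ_s Re ω(Φ^{t′}{0,j_s}) = energyDensityTT' 1 t′ U n − U·Re ω(n_{0↑}n_{0↓})` (translation invariance of the limit + the mean-energy
identification of ground-state torus limits). The (8, 7/8, −¼) instance is obs-lit's `m3_tpm1o4_hoppingDensity_eq`. [cite: BratteliRobinsonII1997, §6.2.4] -/
theorem torusLimit_hoppingDensityTT'_eq (tp : ℝ) {U n : ℝ} (hU : 0 ≤ U) (hn0 : 0 ≤ n) (hn2 : n < 2)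
    (ω : InfVolFermionState 2) (Ls : ℕ → ℕ) (ψ : ∀ L, Fock (Orb (FermionTorus 2 L)))
    (hLs : Tendsto Ls atTop atTop)
    (hψ : ∀ j, IsGroundStateInSector (hubbardTorusTT' (Ls j) 1 tp U) (rectN n (Ls j)) 0 (ψ (Ls j)))
    (hψ1 : ∀ j, star (ψ (Ls j)) ⬝ᵥ ψ (Ls j) = 1) (hω : ω.IsTorusLimitOf ψ Ls) :
    (∑ i : Fin 2, -(1 : ℝ) * ∑ σ : Fin 2,
        ((ω.expect {0, 0 + unitVec i}
            ((cAt 0 (mem_insert_self _ _) σ)ᴴ * cAt (0 + unitVec i) (mem_insert_of_mem (mem_singleton_self _)) σ)).re +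
          (ω.expect {0, 0 + unitVec i}
            ((cAt (0 + unitVec i) (mem_insert_of_mem (mem_singleton_self _)) σ)ᴴ * cAt 0 (mem_insert_self _ _) σ)).re)) +
      ∑ s : Fin 2, (ω.expect {0, 0 + diagVec s} ((diagHoppingFermionInteraction tp).Φ {0, 0 + diagVec s})).re =
      energyDensityTT' 1 tp U n - U * (ω.expect ({0} : Finset (Site 2)) (doccAt0 2)).re := by
  have hTI := hω.isTranslationInvariant
  have hmean : ω.meanEnergy (hubbardTTPrimeFermionInteraction 1 tp U) 1 = energyDensityTT' 1 tp U n :=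
    hω.meanEnergy_hubbardTTPrime_eq_energyDensityTT' 1 tp hU hn0 hn2 hLs hψ hψ1
  have hsplitTT := hTI.meanEnergy_hubbardTTPrime_eq (t' := tp) 1 U
  have hsplit := hTI.hubbardEnergyDensity_eq_docc_add_hopping 1 U
  have hdocc : (ω.expect ({0} : Finset (Site 2)) (doccAt0 2)).re =
      (ω.expect {0} (nAt 0 (mem_singleton_self 0) 0 * nAt 0 (mem_singleton_self 0) 1)).re := rfl
  rw [hdocc]
  rw [hmean] at hsplitTT
  linarith

/-! ## §2 Cap ∧ docc floor ⇒ derived total-hopping floor (any `t′`) -/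

/-- **DERIVED total-hopping FLOOR at `(U, n, t′)` from a cap and a docc floor** (`U ≥ 0`, `0 ≤ n < 2`): if `e(1,t′,U,n) ≤ hi` and
`d_lo ≤ Re ω(n_{0↑}n_{0↓})` for every torus-limit ground state `ω` of the class, then `U·d_lo − hi ≤ −(k_NN(ω) + Σ_s Re ω(Φ^{t′}{0,j_s}))` for
every such `ω` — the magnitude of the total hopping energy is at least `U·d_lo − hi`. Zero compute; the `t′ = 0` twin is
`torusLimit_negKinetic_ge_of_doccFloor_of_cap`. NOT a stiffness statement at `t′ ≠ 0`. [cite: KomaTasaki1994, §1] -/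
theorem torusLimit_negHoppingTT'_ge_of_doccFloor_of_cap (tp : ℝ) {U n : ℝ} (hU : 0 ≤ U) (hn0 : 0 ≤ n) (hn2 : n < 2) {hi : ℚ}
    (hcap : energyDensityTT' 1 tp U n ≤ ((hi : ℚ) : ℝ)) {dlo : ℝ}
    (hd : ∀ (ω : InfVolFermionState 2) (Ls : ℕ → ℕ) (ψ : ∀ L, Fock (Orb (FermionTorus 2 L))),
      Tendsto Ls atTop atTop →
      (∀ j, IsGroundStateInSector (hubbardTorusTT' (Ls j) 1 tp U) (rectN n (Ls j)) 0 (ψ (Ls j))) →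
      (∀ j, star (ψ (Ls j)) ⬝ᵥ ψ (Ls j) = 1) → ω.IsTorusLimitOf ψ Ls →
      dlo ≤ (ω.expect ({0} : Finset (Site 2)) (doccAt0 2)).re) :
    ∀ (ω : InfVolFermionState 2) (Ls : ℕ → ℕ) (ψ : ∀ L, Fock (Orb (FermionTorus 2 L))),
      Tendsto Ls atTop atTop →
      (∀ j, IsGroundStateInSector (hubbardTorusTT' (Ls j) 1 tp U) (rectN n (Ls j)) 0 (ψ (Ls j))) →
      (∀ j, star (ψ (Ls j)) ⬝ᵥ ψ (Ls j) = 1) → ω.IsTorusLimitOf ψ Ls →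
      U * dlo - ((hi : ℚ) : ℝ) ≤
        -((∑ i : Fin 2, -(1 : ℝ) * ∑ σ : Fin 2,
            ((ω.expect {0, 0 + unitVec i}
                ((cAt 0 (mem_insert_self _ _) σ)ᴴ * cAt (0 + unitVec i) (mem_insert_of_mem (mem_singleton_self _)) σ)).re +
              (ω.expect {0, 0 + unitVec i}
                ((cAt (0 + unitVec i) (mem_insert_of_mem (mem_singleton_self _)) σ)ᴴ * cAt 0 (mem_insert_self _ _) σ)).re)) +
          ∑ s : Fin 2, (ω.expect {0, 0 + diagVec s} ((diagHoppingFermionInteraction tp).Φ {0, 0 + diagVec s})).re) := by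
  intro ω Ls ψ hLs hψ hψ1 hω
  rw [torusLimit_hoppingDensityTT'_eq tp hU hn0 hn2 ω Ls ψ hLs hψ hψ1 hω]
  have hdω := hd ω Ls ψ hLs hψ hψ1 hω
  have hmul : U * dlo ≤ U * (ω.expect ({0} : Finset (Site 2)) (doccAt0 2)).re := mul_le_mul_of_nonneg_left hdω hU
  linarith

/-- **Row form** (the shape a menu's `docc lo` claim node delivers at the origin, `Rows/DopedTLCorrOrigin`): a registry cell
`SquareTTPrimeCorrLowerRow t′ U n u d_lo {0} (doccAt0 2)` (its own energy hypothesis `e₀ ≤ u` discharged by `hu`) plus the cap `e₀ ≤ hi` give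
`U·d_lo − hi ≤ −hop_tot(ω)` on the class. The `t′ = 0` twin is `torusLimit_negKinetic_ge_of_doccLowerRow_of_cap`. [cite: KomaTasaki1994, §1] -/
theorem torusLimit_negHoppingTT'_ge_of_doccLowerRow_of_cap (tp : ℝ) {U n : ℝ} (hU : 0 ≤ U) (hn0 : 0 ≤ n) (hn2 : n < 2) {hi u dlo : ℚ}
    (hcap : energyDensityTT' 1 tp U n ≤ ((hi : ℚ) : ℝ)) (hu : energyDensityTT' 1 tp U n ≤ ((u : ℚ) : ℝ))
    (hrow : SquareTTPrimeCorrLowerRow tp U n u dlo {0} (doccAt0 2)) :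
    ∀ (ω : InfVolFermionState 2) (Ls : ℕ → ℕ) (ψ : ∀ L, Fock (Orb (FermionTorus 2 L))),
      Tendsto Ls atTop atTop →
      (∀ j, IsGroundStateInSector (hubbardTorusTT' (Ls j) 1 tp U) (rectN n (Ls j)) 0 (ψ (Ls j))) →
      (∀ j, star (ψ (Ls j)) ⬝ᵥ ψ (Ls j) = 1) → ω.IsTorusLimitOf ψ Ls →
      U * ((dlo : ℚ) : ℝ) - ((hi : ℚ) : ℝ) ≤
        -((∑ i : Fin 2, -(1 : ℝ) * ∑ σ : Fin 2,
            ((ω.expect {0, 0 + unitVec i}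
                ((cAt 0 (mem_insert_self _ _) σ)ᴴ * cAt (0 + unitVec i) (mem_insert_of_mem (mem_singleton_self _)) σ)).re +
              (ω.expect {0, 0 + unitVec i}
                ((cAt (0 + unitVec i) (mem_insert_of_mem (mem_singleton_self _)) σ)ᴴ * cAt 0 (mem_insert_self _ _) σ)).re)) +
          ∑ s : Fin 2, (ω.expect {0, 0 + diagVec s} ((diagHoppingFermionInteraction tp).Φ {0, 0 + diagVec s})).re) :=
  torusLimit_negHoppingTT'_ge_of_doccFloor_of_cap tp hU hn0 hn2 hcap
    (fun ω Ls ψ hLs hψ h1 hω => hrow ω Ls ψ hLs hψ h1 hω hu)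

/-- **Energy-coordinate form**: under the same hypotheses `U·d_lo − hi ≤ U·Re ω(n↑n↓) − e(1,t′,U,n)` (= the total hopping magnitude, by §1).
This is the form `Observables/StiffnessKinematicLeafDensity.lean` §5 bounds from ABOVE by a free-energy floor (`U·D − e₀ ≤ |ℓ|`), so a menu's
`docc lo` edge and a Fermi-sea row box the total hopping energy two-sidedly at any `t′`. [cite: KomaTasaki1994, §1] -/
theorem torusLimit_doccEnergy_ge_of_doccFloor_of_cap (tp : ℝ) {U n : ℝ} (hU : 0 ≤ U) {hi : ℚ}
    (hcap : energyDensityTT' 1 tp U n ≤ ((hi : ℚ) : ℝ)) {dlo : ℝ}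
    (hd : ∀ (ω : InfVolFermionState 2) (Ls : ℕ → ℕ) (ψ : ∀ L, Fock (Orb (FermionTorus 2 L))),
      Tendsto Ls atTop atTop →
      (∀ j, IsGroundStateInSector (hubbardTorusTT' (Ls j) 1 tp U) (rectN n (Ls j)) 0 (ψ (Ls j))) →
      (∀ j, star (ψ (Ls j)) ⬝ᵥ ψ (Ls j) = 1) → ω.IsTorusLimitOf ψ Ls →
      dlo ≤ (ω.expect ({0} : Finset (Site 2)) (doccAt0 2)).re) :
    ∀ (ω : InfVolFermionState 2) (Ls : ℕ → ℕ) (ψ : ∀ L, Fock (Orb (FermionTorus 2 L))),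
      Tendsto Ls atTop atTop →
      (∀ j, IsGroundStateInSector (hubbardTorusTT' (Ls j) 1 tp U) (rectN n (Ls j)) 0 (ψ (Ls j))) →
      (∀ j, star (ψ (Ls j)) ⬝ᵥ ψ (Ls j) = 1) → ω.IsTorusLimitOf ψ Ls →
      U * dlo - ((hi : ℚ) : ℝ) ≤ U * (ω.expect ({0} : Finset (Site 2)) (doccAt0 2)).re - energyDensityTT' 1 tp U n := by
  intro ω Ls ψ hLs hψ hψ1 hω
  have hmul : U * dlo ≤ U * (ω.expect ({0} : Finset (Site 2)) (doccAt0 2)).re :=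
    mul_le_mul_of_nonneg_left (hd ω Ls ψ hLs hψ hψ1 hω) hU
  linarith

/-! ## §3 Consistency: registry row 27 re-derived from the generic theorem (same premises #445 ∧ #257, same literal) -/

/-- **Registry row 27 (`OBS.hop.tpm1o4.TLderivedFloor445x257`) from the GENERIC theorem**: with the cap #445 (`cert_dbt329pair_allk`) and the
LRO docc floor #257 at A0 = (8, 7/8, −¼), `torusLimit_negHoppingTT'_ge_of_doccFloor_of_cap (−1/4)` gives `8·d_lo(#257) − hi(#445) =
453504579244274003115851/2⁷⁹ ≈ 0.7502603 ≤ −hop_tot(ω)` — the SAME literal as `m3_tpm1o4_hoppingDensity_le_derived_r445_r257` (p433540).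
CONDITIONAL on the two nodes BY NAME. [cite: ScalapinoWhiteZhang1993, §II] -/
theorem m3_tpm1o4_negHopping_ge_derived_r445_r257_generic (h445 : cert_dbt329pair_allk)
    (h257 : cert_r257_lro_M3U8tpm1o4_w2_b4_kry1_kry2c3_hop2_Dlo) :
    ∀ (ω : InfVolFermionState 2) (Ls : ℕ → ℕ) (ψ : ∀ L, Fock (Orb (FermionTorus 2 L))),
      Tendsto Ls atTop atTop →
      (∀ j, IsGroundStateInSector (hubbardTorusTT' (Ls j) 1 (-1/4) 8) (rectN (7/8) (Ls j)) 0 (ψ (Ls j))) →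
      (∀ j, star (ψ (Ls j)) ⬝ᵥ ψ (Ls j) = 1) → ω.IsTorusLimitOf ψ Ls →
      (((453504579244274003115851/604462909807314587353088 : ℚ)) : ℝ) ≤
        -((∑ i : Fin 2, -(1 : ℝ) * ∑ σ : Fin 2,
            ((ω.expect {0, 0 + unitVec i}
                ((cAt 0 (mem_insert_self _ _) σ)ᴴ * cAt (0 + unitVec i) (mem_insert_of_mem (mem_singleton_self _)) σ)).re +
              (ω.expect {0, 0 + unitVec i}
                ((cAt (0 + unitVec i) (mem_insert_of_mem (mem_singleton_self _)) σ)ᴴ * cAt 0 (mem_insert_self _ _) σ)).re)) +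
          ∑ s : Fin 2, (ω.expect {0, 0 + diagVec s} ((diagHoppingFermionInteraction (-1/4)).Φ {0, 0 + diagVec s})).re) := by
  intro ω Ls ψ hLs hψ hψ1 hω
  have hE : M3EnergyUpperRow (-1/4) (-12079530027017/17592186044416) := m3_tpm1o4_upper_dbt329pair_allk_of h445
  have hcap : energyDensityTT' 1 (-1/4) 8 (7/8) ≤ (((-12079530027017/17592186044416 : ℚ)) : ℝ) := hE
  have hd : ∀ (ω : InfVolFermionState 2) (Ls : ℕ → ℕ) (ψ : ∀ L, Fock (Orb (FermionTorus 2 L))),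
      Tendsto Ls atTop atTop →
      (∀ j, IsGroundStateInSector (hubbardTorusTT' (Ls j) 1 (-1/4) 8) (rectN (7/8) (Ls j)) 0 (ψ (Ls j))) →
      (∀ j, star (ψ (Ls j)) ⬝ᵥ ψ (Ls j) = 1) → ω.IsTorusLimitOf ψ Ls →
      (((38455087907569911627595/4835703278458516698824704 : ℚ)) : ℝ) ≤ (ω.expect ({0} : Finset (Site 2)) (doccAt0 2)).re :=
    M3CorrLowerRow.uncond (show M3CorrLowerRow (-1/4) (-2948854321395/4398046511104)
        (38455087907569911627595/4835703278458516698824704) {0} (doccAt0 2) from m3_docc_tpm1o4_lowerRow_r257 h257)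
      hE (by norm_num)
  have h := torusLimit_negHoppingTT'_ge_of_doccFloor_of_cap (-1/4) (U := 8) (n := 7/8) (by norm_num) (by norm_num) (by norm_num)
    hcap hd ω Ls ψ hLs hψ hψ1 hω
  have hq : (((453504579244274003115851/604462909807314587353088 : ℚ)) : ℝ) =
      (8 : ℝ) * (((38455087907569911627595/4835703278458516698824704 : ℚ)) : ℝ) -
        (((-12079530027017/17592186044416 : ℚ)) : ℝ) := by
    norm_num
  rw [hq]
  exact h

/-- Literal check (decidable): `8·d_lo(#257) − hi(#445) = 453504579244274003115851/2⁷⁹`, the registry row-27 literal. -/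
theorem m3_tpm1o4_negHopping_derived_r445_r257_generic_literal :
    (8 : ℚ) * (38455087907569911627595/4835703278458516698824704) - (-12079530027017/17592186044416) =
      453504579244274003115851/604462909807314587353088 := by
  norm_num

end Summit.Ventures.CertifiedManyBodySolver.Observables

end
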